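import Literature.Probability.FitznerVanDerHofstad2017.SrwIntegralLargeD
import Mathlib.Analysis.SpecialFunctions.Integrals.Basic
import Mathlib.Data.Nat.Factorial.DoubleFactorial
import HarnessLib

/-!
# SRW remainder lemmas for the uniform-in-`d` certificate: return probabilities,
# the Chernoff tail of `D̂`, and the Hölder split of `I_{j,M}(0)`

CITATION HEADER. This module is part of a certified REPRODUCTION of:
R. Fitzner, R. van der Hofstad, *Generalized approach to the non-backtracking lace expansion*,
Probab. Theory Related Fields **169** (2017) 1041–1119 [NoBLE17] (arXiv:1506.07969), §5 (the SRW
inputs `I_{n,l}(x)`, (5.1) p. 1090) and §2.5 p. 1062 / §6 p. 1104 (the assertion, without proof for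
percolation, that the numerical bounds are monotone in the dimension `d`), as consumed by
*Mean-field behavior for nearest-neighbor percolation in `d > 10`*, Electron. J. Probab. **22**
(2017) no. 43 [FvdH17], Thm 1.1. It continues `SrwIntegralLargeD.lean` (finite Taylor form
`srwI_taylor`, `d`-monotonicity `srwI_zero_dim_anti`, enclosure `abs_srwI_sub_taylor_le`): the
remainder of that enclosure is a finite combination of the quantities `p_M(0;d) = srwLaw d M 0`
(return probabilities of simple random walk) and `I_{j,M}(0;d) = srwI d j M 0`, and a certificate
that is UNIFORM in `d ≥ D₀` needs bounds for them that DECAY in `d` explicitly. This file proves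
three ELEMENTARY such bounds, all kernel facts about the tree's own definitions (`srwLaw`, `srwI`,
`Dhat`, `Chat`, `P`, `μI`); no statement here is quoted from, or attributed to, [NoBLE17]/[FvdH17],
and no hypothesis of any theorem is a programme-internal claim:

* **`srwLaw_zero_even_le`**, `srwLaw_zero_le_of_even` (Part C) — RETURN PROBABILITIES:
  `p_{2n}(0;d) ≤ (2n)!/(4ⁿ n! dⁿ) = (2n-1)‼/(2d)ⁿ` for `d ≥ 1`. Proof: `p_M(0;d) =
  ∫_{[-π,π]^d} D̂(k)^M dk/(2π)^d` (`srwI_zero_eq_srwLaw`, `srwI_zero_eq_integral_phi`) and the even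
  moments of `Σ_j cos k_j` obey `∫ (Σ_j cos k_j)^{2n} dk ≤ (2π)^d (2n)! dⁿ/(4ⁿ n!)`
  (`integral_cs_pow_even_le`, Part B: induction on `d`, deleting one coordinate with
  `measurePreserving_piFinSuccAbove`; the odd cosine moments vanish and the even ones are
  `∫_{-π}^{π} cos^{2n} = 2π (2n)!/(4ⁿ (n!)²)`, Part A, from Mathlib's reduction formula
  `integral_cos_pow`; the comparison of the resulting exact sum with the bound is `(j!)² ≥ j!`
  termwise plus the binomial theorem).
* **`measure_half_le_cs_le`**, `prob_Dhat_ge_half_le` (Part D) — CHERNOFF TAIL OF `D̂`: for every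
  `λ > 0`, `|{k ∈ [-π,π]^d : D̂(k) ≥ 1/2}|/(2π)^d ≤ (e^{-λ/2} m(λ))^d` with
  `m(λ) = ∫_{-π}^{π} e^{λ cos x} dx/(2π)` (Markov's inequality for `e^{λ Σ_j cos k_j}` and the
  product structure of `P d`, exactly as in `Slade2006Prop53.measure_S_le`).
* **`srwI_zero_le_split`** (Part E) — HÖLDER SPLIT: for `1 ≤ j ≤ 4`, `M` even and `d ≥ 11`,
  `I_{j,M}(0;d) ≤ 2^j p_M(0;d) + I_{5,0}(0;d)^{j/5} (|{D̂ ≥ 1/2}|/(2π)^d)^{1-j/5}`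
  (on `{D̂ < 1/2}` one has `Ĉ = 1/(1-D̂) ≤ 2`; on `{D̂ ≥ 1/2}` Hölder with exponents `5/j` and
  `5/(5-j)`; `D̂^M ≤ 1` for even `M`).

Combined with `srwLaw_zero_dim_anti` / `srwI_zero_dim_anti` (`SrwIntegralLargeD.lean`) these make
every remainder term of `abs_srwI_sub_taylor_le` explicitly small, uniformly in `d ≥ D₀`.

## References
* [NoBLE17] R. Fitzner, R. van der Hofstad, PTRF 169 (2017) 1041–1119: (5.1) p. 1090; §2.5
  p. 1062; §6 p. 1104 (bib key `FitznerVanDerHofstad2016NoBLE`).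
* [FvdH17] R. Fitzner, R. van der Hofstad, EJP 22 (2017) no. 43, Thm 1.1, Thm 1.2 p. 5.
* M. Heydenreich, R. van der Hofstad, *Progress in high-dimensional percolation and random graphs*
  (2017), Exercise 5.4 / Prop. 5.5 (bib key `HeydenreichVanDerHofstad2017`) — integrability of
  `Ĉⁿ` on `[-π,π]^d` for `d ≥ 2n+1`, as used from `HvdHTorusShift.lean`.
-/

noncomputable section

open MeasureTheory Real Finset Filter Topology
open scoped BigOperators Nat

namespace Literature.Probability.FitznerVanDerHofstad2017

open Literature.Barriers.CriticalPhenomena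
open Literature.Barriers.CriticalPhenomena.Slade2006Prop53 (P μI)
open Literature.Barriers.CriticalPhenomena.LongRangePhi4 (srwLaw srwLaw_nonneg)

namespace SrwRemainder

variable {d : ℕ}

/-! ### Part A. Cosine moments on `[-π, π]` -/

/-- `∫_{[-π,π]} f dμI = ∫_{-π}^{π} f`. [folklore] -/
theorem integral_μI_eq_intervalIntegral (f : ℝ → ℝ) :
    ∫ x, f x ∂μI = ∫ x in (-π)..π, f x := by
  show ∫ x in Set.Icc (-π) π, f x = _
  rw [integral_Icc_eq_integral_Ioc, ← intervalIntegral.integral_of_le (by linarith [pi_pos])]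

/-- Reduction formula on `[-π,π]`: `∫ cos^(n+2) dμI = (n+1)/(n+2) ∫ cos^n dμI` (the boundary
terms of `integral_cos_pow` vanish since `sin (±π) = 0`). [folklore] -/
theorem integral_cos_pow_succ_succ (n : ℕ) :
    ∫ x, cos x ^ (n + 2) ∂μI = ((n : ℝ) + 1) / (n + 2) * ∫ x, cos x ^ n ∂μI := by
  rw [integral_μI_eq_intervalIntegral, integral_μI_eq_intervalIntegral (fun x => cos x ^ n),
    integral_cos_pow]
  simp [Real.sin_pi]

/-- Odd cosine moments vanish: `∫ cos^(2n+1) dμI = 0`. [folklore] -/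
theorem integral_cos_pow_odd (n : ℕ) : ∫ x, cos x ^ (2 * n + 1) ∂μI = 0 := by
  induction n with
  | zero => simpa using Slade2006Prop53.integral_cos_μI
  | succ n ih =>
    rw [show 2 * (n + 1) + 1 = (2 * n + 1) + 2 by ring, integral_cos_pow_succ_succ, ih, mul_zero]

/-- The normalised even cosine moment `c_n = (2n)!/(4ⁿ (n!)²) = C(2n,n)/4ⁿ`
(so that `∫ cos^(2n) dμI = 2π c_n`). [folklore] -/
def cm (n : ℕ) : ℝ := ((2 * n)! : ℝ) / (4 ^ n * ((n ! : ℝ) * n !))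

/-- `c_0 = 1`. [folklore] -/
theorem cm_zero : cm 0 = 1 := by simp [cm]

/-- `c_{n+1} = c_n (2n+1)/(2n+2)`. [folklore] -/
theorem cm_succ (n : ℕ) : cm (n + 1) = (2 * n + 1) / (2 * n + 2) * cm n := by
  simp only [cm]
  rw [show 2 * (n + 1) = (2 * n + 1) + 1 by ring, Nat.factorial_succ, Nat.factorial_succ (2 * n),
    Nat.factorial_succ n]
  push_cast
  have h1 : ((2 * n)! : ℝ) ≠ 0 := by positivity
  have h2 : (n ! : ℝ) ≠ 0 := by positivity
  field_simp
  ring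

/-- `c_n ≥ 0`. [folklore] -/
theorem cm_nonneg (n : ℕ) : 0 ≤ cm n := by unfold cm; positivity

/-- Even cosine moments: `∫ cos^(2n) dμI = 2π (2n)!/(4ⁿ (n!)²)`. [folklore] -/
theorem integral_cos_pow_even (n : ℕ) : ∫ x, cos x ^ (2 * n) ∂μI = 2 * π * cm n := by
  induction n with
  | zero =>
    simp only [mul_zero, pow_zero, cm_zero, mul_one]
    exact Slade2006Prop53.integral_one_μI
  | succ n ih =>
    rw [show 2 * (n + 1) = 2 * n + 2 by ring, integral_cos_pow_succ_succ, ih, cm_succ]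
    push_cast
    ring

/-! ### Part B. Even moments of `Σ_j cos k_j` on the cube `[-π,π]^d` -/

/-- `cs d k = Σ_j cos (k_j)` (`= d · D̂(k)`). [folklore] -/
def cs (d : ℕ) (k : Fin d → ℝ) : ℝ := ∑ j, cos (k j)

/-- `cs d` is continuous. [folklore] -/
@[fun_prop] theorem continuous_cs (d : ℕ) : Continuous (cs d) := by unfold cs; fun_prop

/-- `|Σ_j cos k_j| ≤ d`. [folklore] -/
theorem abs_cs_le (k : Fin d → ℝ) : |cs d k| ≤ d := by
  unfold cs
  calc |∑ j, cos (k j)| ≤ ∑ j, |cos (k j)| := abs_sum_le_sum_abs _ _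
    _ ≤ ∑ _j : Fin d, (1 : ℝ) := sum_le_sum fun j _ => abs_cos_le_one (k j)
    _ = d := by simp

/-- `D̂(k) = (Σ_j cos k_j)/d`. [folklore] -/
theorem Dhat_eq_cs_div (k : Fin d → ℝ) : Dhat d k = cs d k / d := rfl

/-- Splitting off coordinate `0`: `cs (d+1) k = cos k₀ + cs d (k ∘ succAbove 0)`. [folklore] -/
theorem cs_succ (k : Fin (d + 1) → ℝ) :
    cs (d + 1) k = cos (k 0) + cs d (fun j => k (Fin.succAbove 0 j)) := by
  unfold cs; rw [Fin.sum_univ_succAbove _ 0]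

/-- **Moment recursion in the dimension**:
`∫_{[-π,π]^{d+1}} (Σ_j cos k_j)^n dk = Σ_{i ≤ n} C(n,i) (∫_{-π}^{π} cos^i) ∫_{[-π,π]^d} (Σ_j cos k_j)^{n-i}`
(delete coordinate `0`: `measurePreserving_piFinSuccAbove`, binomial theorem, Fubini for products).
[folklore] -/
theorem integral_cs_pow_succ (d n : ℕ) :
    ∫ k, cs (d + 1) k ^ n ∂P (d + 1) =
      ∑ i ∈ range (n + 1), ((n.choose i : ℕ) : ℝ) *
        ((∫ x, cos x ^ i ∂μI) * ∫ k, cs d k ^ (n - i) ∂P d) := by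
  have hmp : MeasurePreserving (MeasurableEquiv.piFinSuccAbove (fun _ : Fin (d + 1) => ℝ) 0)
      (P (d + 1)) (μI.prod (P d)) :=
    measurePreserving_piFinSuccAbove (fun _ : Fin (d + 1) => μI) 0
  have h := hmp.integral_comp' (g := fun z : ℝ × (Fin d → ℝ) => (cos z.1 + cs d z.2) ^ n)
  have e1 : ∫ k, cs (d + 1) k ^ n ∂P (d + 1) =
      ∫ k, (cos (MeasurableEquiv.piFinSuccAbove (fun _ : Fin (d + 1) => ℝ) 0 k).1 +
        cs d (MeasurableEquiv.piFinSuccAbove (fun _ : Fin (d + 1) => ℝ) 0 k).2) ^ n ∂P (d + 1) := by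
    congr 1; funext k; rw [cs_succ]; rfl
  rw [e1, h]
  simp_rw [add_pow]
  rw [integral_finsetSum _ (fun i _ => ?_)]
  · refine sum_congr rfl fun i _ => ?_
    rw [integral_mul_const, integral_prod_mul (μ := μI) (ν := P d) (fun x : ℝ => cos x ^ i)
      (fun y : Fin d → ℝ => cs d y ^ (n - i))]
    ring
  · -- each term is bounded and continuous on a finite measure space
    refine (integrable_const ((d : ℝ) ^ (n - i) * (n.choose i : ℝ))).mono'
      (Continuous.aestronglyMeasurable (by fun_prop)) (ae_of_all _ fun z => ?_)
    rw [Real.norm_eq_abs, abs_mul, abs_mul, abs_pow, abs_pow, Nat.abs_cast]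
    refine mul_le_mul_of_nonneg_right ?_ (Nat.cast_nonneg _)
    calc |cos z.1| ^ i * |cs d z.2| ^ (n - i) ≤ 1 ^ i * (d : ℝ) ^ (n - i) :=
          mul_le_mul (pow_le_pow_left₀ (abs_nonneg _) (abs_cos_le_one _) _)
            (pow_le_pow_left₀ (abs_nonneg _) (abs_cs_le _) _) (by positivity) (by positivity)
      _ = (d : ℝ) ^ (n - i) := by rw [one_pow, one_mul]

/-- `B d n = (2n)! dⁿ/(4ⁿ n!)` (`= (2n-1)‼ (d/2)ⁿ`): the bound for the `2n`-th moment of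
`Σ_j cos k_j`, per unit volume `(2π)^d`. [folklore] -/
def B (d n : ℕ) : ℝ := ((2 * n)! : ℝ) * (d : ℝ) ^ n / (4 ^ n * n !)

/-- `B d n ≥ 0`. [folklore] -/
theorem B_nonneg (d n : ℕ) : 0 ≤ B d n := by unfold B; positivity

/-- Parity split of a sum over `range (2n+1)`. [folklore] -/
theorem sum_range_even_odd (f : ℕ → ℝ) (n : ℕ) :
    ∑ i ∈ range (2 * n + 1), f i =
      ∑ j ∈ range (n + 1), f (2 * j) + ∑ j ∈ range n, f (2 * j + 1) := by
  induction n with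
  | zero => simp
  | succ n ih =>
    have h2 : 2 * (n + 1) + 1 = (2 * n + 1) + 1 + 1 := by ring
    rw [h2, sum_range_succ f (2 * n + 1 + 1), sum_range_succ f (2 * n + 1), ih,
      sum_range_succ (fun j => f (2 * j)) (n + 1), sum_range_succ (fun j => f (2 * j + 1)) n,
      show 2 * (n + 1) = 2 * n + 1 + 1 by ring]
    ring

/-- The exact even term: `C(2n,2j) c_j B_d(n-j) = (2n)! d^{n-j}/(4ⁿ (j!)² (n-j)!)`. [folklore] -/
theorem choose_mul_cm_mul_B (d : ℕ) {n j : ℕ} (hj : j ≤ n) :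
    (((2 * n).choose (2 * j) : ℕ) : ℝ) * cm j * B d (n - j) =
      ((2 * n)! : ℝ) * (d : ℝ) ^ (n - j) / (4 ^ n * ((j ! : ℝ) * j !) * (n - j)!) := by
  have h1 : (((2 * n).choose (2 * j) : ℕ) : ℝ) * (2 * j)! * (2 * (n - j))! = (2 * n)! := by
    have := Nat.choose_mul_factorial_mul_factorial (show 2 * j ≤ 2 * n by omega)
    rw [show 2 * n - 2 * j = 2 * (n - j) by omega] at this
    exact_mod_cast this
  have h4 : (4 : ℝ) ^ n = 4 ^ j * 4 ^ (n - j) := by rw [← pow_add, Nat.add_sub_cancel' hj]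
  unfold cm B
  rw [← h1, h4]
  have : ((2 * j)! : ℝ) ≠ 0 := by positivity
  have : ((2 * (n - j))! : ℝ) ≠ 0 := by positivity
  have : (j ! : ℝ) ≠ 0 := by positivity
  have : ((n - j)! : ℝ) ≠ 0 := by positivity
  field_simp

/-- The binomial theorem in the form `Σ_{j ≤ n} (2n)! d^{n-j}/(4ⁿ j! (n-j)!) = B_{d+1}(n)`.
[folklore] -/
theorem sum_U_eq_B_succ (d n : ℕ) :
    ∑ j ∈ range (n + 1), ((2 * n)! : ℝ) * (d : ℝ) ^ (n - j) / (4 ^ n * j ! * (n - j)!) =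
      B (d + 1) n := by
  have hterm : ∀ j ∈ range (n + 1),
      ((2 * n)! : ℝ) * (d : ℝ) ^ (n - j) / (4 ^ n * j ! * (n - j)!) =
        ((2 * n)! : ℝ) / (4 ^ n * n !) * ((1 : ℝ) ^ j * (d : ℝ) ^ (n - j) * (n.choose j : ℕ)) := by
    intro j hj
    rw [mem_range] at hj
    have hc : ((n.choose j : ℕ) : ℝ) * j ! * (n - j)! = n ! := by
      exact_mod_cast Nat.choose_mul_factorial_mul_factorial (Nat.lt_succ_iff.mp hj)
    have hC : ((n.choose j : ℕ) : ℝ) ≠ 0 := by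
      exact_mod_cast (Nat.choose_pos (Nat.lt_succ_iff.mp hj)).ne'
    have : (j ! : ℝ) ≠ 0 := by positivity
    have : ((n - j)! : ℝ) ≠ 0 := by positivity
    rw [← hc, one_pow, one_mul]
    field_simp
  rw [sum_congr rfl hterm, ← mul_sum, ← add_pow, B]
  push_cast
  ring

/-- Termwise comparison summed: `Σ_{j ≤ n} C(2n,2j) c_j B_d(n-j) ≤ B_{d+1}(n)` (`(j!)² ≥ j!`).
[folklore] -/
theorem sum_choose_cm_B_le (d n : ℕ) :
    ∑ j ∈ range (n + 1), (((2 * n).choose (2 * j) : ℕ) : ℝ) * cm j * B d (n - j) ≤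
      B (d + 1) n := by
  rw [← sum_U_eq_B_succ]
  refine sum_le_sum fun j hj => ?_
  rw [mem_range] at hj
  rw [choose_mul_cm_mul_B d (Nat.lt_succ_iff.mp hj)]
  have hj1 : (1 : ℝ) ≤ j ! := by exact_mod_cast Nat.factorial_pos j
  have hjj : (j ! : ℝ) ≤ j ! * j ! := le_mul_of_one_le_right (by positivity) hj1
  refine div_le_div_of_nonneg_left (by positivity) (by positivity) ?_
  exact mul_le_mul_of_nonneg_right (mul_le_mul_of_nonneg_left hjj (by positivity))
    (by positivity)

/-- **Even moments of `Σ_j cos k_j`**: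
`∫_{[-π,π]^d} (Σ_j cos k_j)^{2n} dk ≤ (2π)^d (2n)! dⁿ/(4ⁿ n!) = (2π)^d (2n-1)‼ (d/2)ⁿ`.
Induction on `d`: delete one coordinate (`integral_cs_pow_succ`); odd cosine moments vanish;
even ones are `2π c_j`; then `sum_choose_cm_B_le`. (The bound is the Gaussian moment
`E[(Σ_j cos k_j)^{2n}] ≤ (2n-1)‼ σ^{2n}`, `σ² = d/2`, valid here because every mixed moment of the
`cos k_j` is dominated by the corresponding Gaussian one.) [folklore] -/
theorem integral_cs_pow_even_le : ∀ (d n : ℕ),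
    ∫ k, cs d k ^ (2 * n) ∂P d ≤ (2 * π) ^ d * B d n := by
  intro d
  induction d with
  | zero =>
    intro n
    have h0 : ∀ k : Fin 0 → ℝ, cs 0 k = 0 := fun k => by simp [cs]
    have hP : (P 0).real Set.univ = 1 := by
      simp [Measure.real, P]
    simp_rw [h0]
    rw [integral_const, smul_eq_mul, hP, one_mul, pow_zero, one_mul]
    rcases Nat.eq_zero_or_pos n with rfl | hn
    · simp [B]
    · rw [zero_pow (by omega)]; exact B_nonneg 0 n
  | succ d ih =>
    intro n
    rw [integral_cs_pow_succ, sum_range_even_odd]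
    have hodd : ∑ j ∈ range n, (((2 * n).choose (2 * j + 1) : ℕ) : ℝ) *
        ((∫ x, cos x ^ (2 * j + 1) ∂μI) * ∫ k, cs d k ^ (2 * n - (2 * j + 1)) ∂P d) = 0 := by
      refine sum_eq_zero fun j _ => ?_
      rw [integral_cos_pow_odd, zero_mul, mul_zero]
    rw [hodd, add_zero]
    calc ∑ j ∈ range (n + 1), (((2 * n).choose (2 * j) : ℕ) : ℝ) *
          ((∫ x, cos x ^ (2 * j) ∂μI) * ∫ k, cs d k ^ (2 * n - 2 * j) ∂P d)
        ≤ ∑ j ∈ range (n + 1), (((2 * n).choose (2 * j) : ℕ) : ℝ) *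
          ((2 * π * cm j) * ((2 * π) ^ d * B d (n - j))) := by
          refine sum_le_sum fun j hj => ?_
          rw [mem_range] at hj
          rw [integral_cos_pow_even, show 2 * n - 2 * j = 2 * (n - j) by omega]
          have hc : 0 ≤ 2 * π * cm j := by have := cm_nonneg j; positivity
          exact mul_le_mul_of_nonneg_left (mul_le_mul_of_nonneg_left (ih (n - j)) hc)
            (Nat.cast_nonneg _)
      _ = (2 * π) ^ (d + 1) *
            ∑ j ∈ range (n + 1), (((2 * n).choose (2 * j) : ℕ) : ℝ) * cm j * B d (n - j) := by
          rw [mul_sum]; refine sum_congr rfl fun j _ => ?_; ring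
      _ ≤ (2 * π) ^ (d + 1) * B (d + 1) n :=
          mul_le_mul_of_nonneg_left (sum_choose_cm_B_le d n) (by positivity)

/-! ### Part C. E1: return probabilities `p_{2n}(0;d) ≤ (2n-1)‼/(2d)ⁿ` -/

/-- `p_M(0;d) = (∫_{[-π,π]^d} (Σ_j cos k_j)^M dk) / d^M / (2π)^d`. [folklore] -/
theorem srwLaw_zero_eq_integral_cs (d M : ℕ) :
    srwLaw d M 0 = (∫ k, cs d k ^ M ∂P d) / (d : ℝ) ^ M / (2 * π) ^ d := by
  rw [← srwI_zero_eq_srwLaw, DimMono.srwI_zero_eq_integral_phi]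
  congr 1
  simp only [DimMono.phi, pow_zero, mul_one, Dhat_eq_cs_div, div_pow]
  rw [integral_div]

/-- **E1 (return probability bound).** For `d ≥ 1` and every `n`:
`p_{2n}(0;d) ≤ (2n)!/(4ⁿ n! dⁿ)`. [folklore] -/
theorem srwLaw_zero_even_le (hd : 1 ≤ d) (n : ℕ) :
    srwLaw d (2 * n) 0 ≤ ((2 * n)! : ℝ) / (4 ^ n * n ! * (d : ℝ) ^ n) := by
  have hdpos : (0 : ℝ) < d := by exact_mod_cast hd
  rw [srwLaw_zero_eq_integral_cs]
  calc (∫ k, cs d k ^ (2 * n) ∂P d) / (d : ℝ) ^ (2 * n) / (2 * π) ^ d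
      ≤ (2 * π) ^ d * B d n / (d : ℝ) ^ (2 * n) / (2 * π) ^ d :=
        div_le_div_of_nonneg_right (div_le_div_of_nonneg_right (integral_cs_pow_even_le d n)
          (by positivity)) (by positivity)
    _ = ((2 * n)! : ℝ) / (4 ^ n * n ! * (d : ℝ) ^ n) := by
        unfold B
        rw [show (d : ℝ) ^ (2 * n) = (d : ℝ) ^ n * (d : ℝ) ^ n by rw [← pow_add, two_mul]]
        have : (2 * π : ℝ) ^ d ≠ 0 := by positivity
        have : (d : ℝ) ^ n ≠ 0 := by positivity
        field_simp

/-- `(2n)!/(4ⁿ n!) = (2n-1)‼/2ⁿ`. [folklore] -/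
theorem factorial_two_mul_div (n : ℕ) :
    ((2 * n)! : ℝ) / (4 ^ n * n !) = ((2 * n - 1)‼ : ℝ) / 2 ^ n := by
  rcases Nat.eq_zero_or_pos n with rfl | hn
  · simp
  have h1 : ((2 * n)! : ℝ) = 2 ^ n * n ! * (2 * n - 1)‼ := by
    obtain ⟨m, rfl⟩ := Nat.exists_eq_succ_of_ne_zero hn.ne'
    have h : (2 * (m + 1))! = 2 ^ (m + 1) * (m + 1)! * (2 * (m + 1) - 1)‼ := by
      rw [show 2 * (m + 1) - 1 = 2 * m + 1 by omega, show 2 * (m + 1) = (2 * m + 1) + 1 by ring,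
        Nat.factorial_eq_mul_doubleFactorial, show 2 * m + 1 + 1 = 2 * (m + 1) by ring,
        Nat.doubleFactorial_two_mul]
    exact_mod_cast h
  rw [h1, show (4 : ℝ) ^ n = 2 ^ n * 2 ^ n by rw [← mul_pow]; norm_num]
  have : (n ! : ℝ) ≠ 0 := by positivity
  field_simp

/-- **E1, double-factorial form.** For `d ≥ 1`: `p_{2n}(0;d) ≤ (2n-1)‼/(2d)ⁿ`. [folklore] -/
theorem srwLaw_zero_even_le' (hd : 1 ≤ d) (n : ℕ) :
    srwLaw d (2 * n) 0 ≤ ((2 * n - 1)‼ : ℝ) / (2 * (d : ℝ)) ^ n := by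
  have h := srwLaw_zero_even_le hd n
  rwa [← div_div, factorial_two_mul_div, div_div, ← mul_pow] at h

/-- **E1 for an even number of steps `M`.** For `d ≥ 1` and `M` even:
`p_M(0;d) ≤ (M-1)‼/(2d)^{M/2}`. [folklore] -/
theorem srwLaw_zero_le_of_even (hd : 1 ≤ d) {M : ℕ} (hM : Even M) :
    srwLaw d M 0 ≤ ((M - 1)‼ : ℝ) / (2 * (d : ℝ)) ^ (M / 2) := by
  obtain ⟨n, rfl⟩ := hM
  rw [← two_mul, show 2 * n / 2 = n by omega]
  exact srwLaw_zero_even_le' hd n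

/-! ### Part D. E2: the Chernoff tail of `D̂` -/

/-- `m(λ) = ∫_{-π}^{π} e^{λ cos x} dx/(2π)`, the mean of `e^{λ cos}` over the circle (this is the
modified Bessel function `I₀(λ)`; only the definite integral is used here). [folklore] -/
def mgfCos (lam : ℝ) : ℝ := (∫ x, exp (lam * cos x) ∂μI) / (2 * π)

/-- `m(λ) ≥ 0`. [folklore] -/
theorem mgfCos_nonneg (lam : ℝ) : 0 ≤ mgfCos lam :=
  div_nonneg (integral_nonneg fun _ => (exp_pos _).le) (by positivity)

/-- **E2 (Chernoff tail of `D̂`, measure form).** For every `λ > 0`: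
`|{k ∈ [-π,π]^d : Σ_j cos k_j ≥ d/2}| ≤ (e^{-λ/2} ∫_{-π}^{π} e^{λ cos x} dx)^d`
(Markov's inequality for `exp (λ (Σ_j cos k_j - d/2))` and the product structure of the cube,
as in `Slade2006Prop53.measure_S_le`). [folklore] -/
theorem measure_half_le_cs_le (d : ℕ) {lam : ℝ} (hlam : 0 < lam) :
    P d {k | (d : ℝ) / 2 ≤ cs d k} ≤
      ENNReal.ofReal ((exp (-(lam / 2)) * ∫ x, exp (lam * cos x) ∂μI) ^ d) := by
  set G : (Fin d → ℝ) → ℝ := fun k => exp (lam * (cs d k - d / 2)) with hG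
  have hG_meas : Measurable G :=
    (continuous_const.mul ((continuous_cs d).sub continuous_const)).rexp.measurable
  -- Markov's inequality
  have h1 : P d {k | (d : ℝ) / 2 ≤ cs d k} ≤ ∫⁻ k, ENNReal.ofReal (G k) ∂P d := by
    have hM := mul_meas_ge_le_lintegral (μ := P d) hG_meas.ennreal_ofReal 1
    rw [one_mul] at hM
    refine (measure_mono fun k hk => ?_).trans hM
    simp only [Set.mem_setOf_eq] at hk ⊢
    rw [ENNReal.one_le_ofReal]
    exact one_le_exp (mul_nonneg hlam.le (sub_nonneg.2 hk))
  have hG_int : Integrable G (P d) := by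
    refine (integrable_const (exp (lam * (d / 2)))).mono' hG_meas.aestronglyMeasurable
      (ae_of_all _ fun k => ?_)
    rw [Real.norm_eq_abs, abs_of_pos (exp_pos _)]
    apply exp_le_exp.2
    have := (abs_le.1 (abs_cs_le (d := d) k)).2
    nlinarith
  have h2 : ∫⁻ k, ENNReal.ofReal (G k) ∂P d = ENNReal.ofReal (∫ k, G k ∂P d) :=
    (ofReal_integral_eq_lintegral_ofReal hG_int (ae_of_all _ fun _ => (exp_pos _).le)).symm
  have h3 : ∫ k, G k ∂P d = (exp (-(lam / 2)) * ∫ x, exp (lam * cos x) ∂μI) ^ d := by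
    have hGk : ∀ k, G k = ∏ j, (exp (-(lam / 2)) * exp (lam * cos (k j))) := by
      intro k
      simp_rw [← Real.exp_add]
      rw [← Real.exp_sum]
      simp only [hG, cs]
      congr 1
      rw [sum_add_distrib, sum_const, card_univ, Fintype.card_fin, nsmul_eq_mul, ← mul_sum]
      ring
    simp_rw [hGk]
    have := integral_fintype_prod_eq_pow (ι := Fin d) (μ := μI)
      (fun x : ℝ => exp (-(lam / 2)) * exp (lam * cos x))
    rw [integral_const_mul, Fintype.card_fin] at this
    exact this
  rw [h2, h3] at h1
  exact h1

/-- **E2 (normalised form).** For `d ≥ 1` and every `λ > 0`: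
`|{k ∈ [-π,π]^d : D̂(k) ≥ 1/2}|/(2π)^d ≤ (e^{-λ/2} m(λ))^d`, `m(λ) = ∫_{-π}^{π} e^{λ cos x} dx/(2π)`.
[folklore] -/
theorem prob_Dhat_ge_half_le (hd : 1 ≤ d) {lam : ℝ} (hlam : 0 < lam) :
    (P d).real {k | (1 : ℝ) / 2 ≤ Dhat d k} / (2 * π) ^ d ≤ (exp (-(lam / 2)) * mgfCos lam) ^ d := by
  have hdpos : (0 : ℝ) < d := by exact_mod_cast hd
  have hset : {k : Fin d → ℝ | (1 : ℝ) / 2 ≤ Dhat d k} = {k | (d : ℝ) / 2 ≤ cs d k} := by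
    ext k
    simp only [Set.mem_setOf_eq, Dhat_eq_cs_div, le_div_iff₀ hdpos]
    constructor <;> intro h <;> linarith
  have hI : 0 ≤ ∫ x, exp (lam * cos x) ∂μI := integral_nonneg fun _ => (exp_pos _).le
  have hnn : 0 ≤ (exp (-(lam / 2)) * ∫ x, exp (lam * cos x) ∂μI) ^ d := by positivity
  have h' : (P d).real {k | (d : ℝ) / 2 ≤ cs d k} ≤
      (exp (-(lam / 2)) * ∫ x, exp (lam * cos x) ∂μI) ^ d :=
    ENNReal.toReal_le_of_le_ofReal hnn (measure_half_le_cs_le d hlam)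
  rw [hset, div_le_iff₀ (by positivity), ← mul_pow]
  refine h'.trans (le_of_eq ?_)
  congr 1
  unfold mgfCos
  field_simp

/-! ### Part E. E3: the Hölder split of `I_{j,M}(0)` at `{D̂ ≥ 1/2}` -/

/-- Normalisation algebra for the Hölder split:
`(X V + (V a)^r m^{1-r})/V = X + a^r (m/V)^{1-r}` for `V > 0`, `a, m ≥ 0`. [folklore] -/
theorem div_add_rpow_eq {V X a m r : ℝ} (hV : 0 < V) (ha : 0 ≤ a) (hm : 0 ≤ m) :
    (X * V + (V * a) ^ r * m ^ (1 - r)) / V = X + a ^ r * (m / V) ^ (1 - r) := by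
  have h1 : V = V ^ r * V ^ (1 - r) := by rw [← Real.rpow_add hV]; simp
  have h2 : V ^ (1 - r) ≠ 0 := (Real.rpow_pos_of_pos hV _).ne'
  have h3 : V ^ r ≠ 0 := (Real.rpow_pos_of_pos hV _).ne'
  rw [Real.mul_rpow hV.le ha, Real.div_rpow hm hV.le, add_div]
  congr 1
  · field_simp
  · rw [show V ^ r * a ^ r * m ^ (1 - r) / V = V ^ r * a ^ r * m ^ (1 - r) / (V ^ r * V ^ (1 - r))
      from by rw [← h1]]
    field_simp

/-- `I_{5,0}(0;d) = ∫ Ĉ⁵ dk/(2π)^d`. [folklore] -/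
theorem srwI_five_zero_eq (d : ℕ) :
    srwI d 5 0 0 = (∫ k, Chat d 1 k ^ 5 ∂P d) / (2 * π) ^ d := by
  simp only [srwI, pow_zero, DhatSym_zero, mul_one, one_mul]

/-- **E3 (Hölder split).** For `1 ≤ j ≤ 4`, `M` even and `d ≥ 11`:
`I_{j,M}(0;d) ≤ 2^j p_M(0;d) + I_{5,0}(0;d)^{j/5} · (|{D̂ ≥ 1/2}|/(2π)^d)^{1-j/5}`.
On `{D̂ < 1/2}`: `Ĉ = 1/(1-D̂) ≤ 2` and `D̂^M ≥ 0`; on `{D̂ ≥ 1/2}`: `D̂^M ≤ 1` and Hölder's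
inequality with exponents `5/j` and `5/(5-j)` (`Ĉ⁵` is integrable on the cube for `d ≥ 11`,
Heydenreich–van der Hofstad Prop. 5.5, `integrable_Chat_pow`). [folklore] -/
theorem srwI_zero_le_split {j : ℕ} (hj1 : 1 ≤ j) (hj4 : j ≤ 4) {M : ℕ} (hM : Even M)
    (hd : 11 ≤ d) :
    srwI d j M 0 ≤ 2 ^ j * srwLaw d M 0 +
      srwI d 5 0 0 ^ ((j : ℝ) / 5) *
        ((P d).real {k | (1 : ℝ) / 2 ≤ Dhat d k} / (2 * π) ^ d) ^ (1 - (j : ℝ) / 5) := by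
  set A : Set (Fin d → ℝ) := {k | (1 : ℝ) / 2 ≤ Dhat d k} with hA_def
  set r : ℝ := (j : ℝ) / 5 with hr
  have hA : MeasurableSet A := measurableSet_le measurable_const (continuous_Dhat d).measurable
  have hV : (0 : ℝ) < (2 * π) ^ d := by positivity
  have hj0 : (j : ℝ) ≠ 0 := by exact_mod_cast (show j ≠ 0 by omega)
  have hj5 : (j : ℝ) < 5 := by exact_mod_cast (show j < 5 by omega)
  -- the integrand of `I_{j,M}(0)` and integrability facts
  have e0 : srwI d j M 0 = (∫ k, Dhat d k ^ M * Chat d 1 k ^ j ∂P d) / (2 * π) ^ d := by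
    simp only [srwI, DhatSym_zero, mul_one]
  have hF : Integrable (fun k => Dhat d k ^ M * Chat d 1 k ^ j) (P d) :=
    integrable_weight_mul_Chat_pow (by omega) ((continuous_Dhat d).measurable.pow_const M)
      fun k => by rw [abs_pow]; exact abs_Dhat_pow_le_one M k
  have hC5 : Integrable (fun k => Chat d 1 k ^ 5) (P d) :=
    integrable_Chat_pow 5 (by omega) zero_le_one le_rfl
  have hCj : Integrable (fun k => Chat d 1 k ^ j) (P d) :=
    integrable_Chat_pow j (by omega) zero_le_one le_rfl
  have hDM : Integrable (fun k => Dhat d k ^ M) (P d) :=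
    (integrable_const (1 : ℝ)).mono' ((continuous_Dhat d).pow M).aestronglyMeasurable
      (ae_of_all _ fun k => by rw [Real.norm_eq_abs, abs_pow]; exact abs_Dhat_pow_le_one M k)
  -- `∫ D̂^M = (2π)^d p_M(0)` and `∫ Ĉ⁵ = (2π)^d I_{5,0}(0)`
  have hpM : ∫ k, Dhat d k ^ M ∂P d = (2 * π) ^ d * srwLaw d M 0 := by
    have h := DimMono.srwI_zero_eq_integral_phi d 0 M
    simp only [DimMono.phi, pow_zero, mul_one, srwI_zero_eq_srwLaw] at h
    rw [h]; field_simp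
  have hI5 : ∫ k, Chat d 1 k ^ 5 ∂P d = (2 * π) ^ d * srwI d 5 0 0 := by
    rw [srwI_five_zero_eq]; field_simp
  -- (1) the piece `{D̂ < 1/2}`: `Ĉ ≤ 2`
  have h1 : ∫ k in Aᶜ, Dhat d k ^ M * Chat d 1 k ^ j ∂P d ≤
      2 ^ j * srwLaw d M 0 * (2 * π) ^ d := by
    calc ∫ k in Aᶜ, Dhat d k ^ M * Chat d 1 k ^ j ∂P d
        ≤ ∫ k in Aᶜ, 2 ^ j * Dhat d k ^ M ∂P d := by
          refine setIntegral_mono_on hF.integrableOn (hDM.const_mul _).integrableOn hA.compl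
            fun k hk => ?_
          have hk' : Dhat d k < 1 / 2 := by
            simpa only [hA_def, Set.mem_compl_iff, Set.mem_setOf_eq, not_le] using hk
          have hCle : Chat d 1 k ≤ 2 := by
            rw [Chat_def, one_mul, div_le_iff₀ (by linarith)]; linarith
          calc Dhat d k ^ M * Chat d 1 k ^ j ≤ Dhat d k ^ M * 2 ^ j :=
                mul_le_mul_of_nonneg_left (pow_le_pow_left₀ (Chat_one_nonneg k) hCle j)
                  (hM.pow_nonneg _)
            _ = 2 ^ j * Dhat d k ^ M := mul_comm _ _
      _ = 2 ^ j * ∫ k in Aᶜ, Dhat d k ^ M ∂P d := integral_const_mul _ _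
      _ ≤ 2 ^ j * ∫ k, Dhat d k ^ M ∂P d :=
          mul_le_mul_of_nonneg_left
            (setIntegral_le_integral hDM (ae_of_all _ fun k => hM.pow_nonneg _)) (by positivity)
      _ = 2 ^ j * srwLaw d M 0 * (2 * π) ^ d := by rw [hpM]; ring
  -- (2) the piece `{D̂ ≥ 1/2}`: Hölder with exponents `5/j`, `5/(5-j)` on `P|_A`
  have hpq : Real.HolderConjugate (5 / (j : ℝ)) (5 / (5 - (j : ℝ))) := by
    refine Real.holderConjugate_iff.2 ⟨(one_lt_div (by positivity)).2 hj5, ?_⟩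
    rw [inv_div, inv_div]; ring
  have hpow : ∀ k : Fin d → ℝ, (Chat d 1 k ^ j) ^ (5 / (j : ℝ)) = Chat d 1 k ^ 5 := by
    intro k
    rw [← Real.rpow_natCast _ j, ← Real.rpow_mul (Chat_one_nonneg k),
      show ((j : ℕ) : ℝ) * (5 / (j : ℝ)) = ((5 : ℕ) : ℝ) by push_cast; field_simp,
      Real.rpow_natCast]
  have hfL : MemLp (fun k => Chat d 1 k ^ j) (ENNReal.ofReal (5 / (j : ℝ)))
      ((P d).restrict A) := by
    have hp0 : ENNReal.ofReal (5 / (j : ℝ)) ≠ 0 := by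
      rw [Ne, ENNReal.ofReal_eq_zero, not_le]; positivity
    refine (integrable_norm_rpow_iff hCj.aestronglyMeasurable.restrict hp0
      ENNReal.ofReal_ne_top).1 ?_
    have hfun : (fun k => ‖Chat d 1 k ^ j‖ ^ (ENNReal.ofReal (5 / (j : ℝ))).toReal) =
        fun k => Chat d 1 k ^ 5 := by
      funext k
      rw [ENNReal.toReal_ofReal (by positivity),
        Real.norm_of_nonneg (pow_nonneg (Chat_one_nonneg k) j), hpow]
    rw [hfun]
    exact hC5.integrableOn
  have hgL : MemLp (fun _ : Fin d → ℝ => (1 : ℝ)) (ENNReal.ofReal (5 / (5 - (j : ℝ))))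
      ((P d).restrict A) := memLp_const 1
  have hH := integral_mul_le_Lp_mul_Lq_of_nonneg (μ := (P d).restrict A) hpq
    (f := fun k => Chat d 1 k ^ j) (g := fun _ => (1 : ℝ))
    (ae_of_all _ fun k => pow_nonneg (Chat_one_nonneg k) j) (ae_of_all _ fun _ => zero_le_one)
    hfL hgL
  have hint5 : ∫ k in A, (Chat d 1 k ^ j) ^ (5 / (j : ℝ)) ∂P d = ∫ k in A, Chat d 1 k ^ 5 ∂P d :=
    integral_congr_ae (ae_of_all _ fun k => hpow k)
  have hone : ∫ _k in A, (1 : ℝ) ^ (5 / (5 - (j : ℝ))) ∂P d = (P d).real A := by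
    simp only [Real.one_rpow, setIntegral_const, smul_eq_mul, mul_one]
  have hexp1 : 1 / (5 / (j : ℝ)) = r := by rw [hr, one_div_div]
  have hexp2 : 1 / (5 / (5 - (j : ℝ))) = 1 - r := by rw [hr, one_div_div]; ring
  simp only [mul_one] at hH
  rw [hint5, hone, hexp1, hexp2] at hH
  have h2 : ∫ k in A, Dhat d k ^ M * Chat d 1 k ^ j ∂P d ≤
      ((2 * π) ^ d * srwI d 5 0 0) ^ r * ((P d).real A) ^ (1 - r) := by
    calc ∫ k in A, Dhat d k ^ M * Chat d 1 k ^ j ∂P d ≤ ∫ k in A, Chat d 1 k ^ j ∂P d := by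
          refine setIntegral_mono_on hF.integrableOn hCj.integrableOn hA fun k _ => ?_
          have hDle : Dhat d k ^ M ≤ 1 := by rw [← hM.pow_abs]; exact abs_Dhat_pow_le_one M k
          exact mul_le_of_le_one_left (pow_nonneg (Chat_one_nonneg k) j) hDle
      _ ≤ (∫ k in A, Chat d 1 k ^ 5 ∂P d) ^ r * ((P d).real A) ^ (1 - r) := hH
      _ ≤ ((2 * π) ^ d * srwI d 5 0 0) ^ r * ((P d).real A) ^ (1 - r) := by
          rw [← hI5]
          have hr0 : 0 ≤ r := by rw [hr]; positivity
          refine mul_le_mul_of_nonneg_right (Real.rpow_le_rpow ?_ ?_ hr0)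
            (Real.rpow_nonneg measureReal_nonneg _)
          · exact setIntegral_nonneg hA fun k _ => pow_nonneg (Chat_one_nonneg k) 5
          · exact setIntegral_le_integral hC5 (ae_of_all _ fun k => pow_nonneg (Chat_one_nonneg k) 5)
  -- assemble and normalise by `(2π)^d`
  have hmain : ∫ k, Dhat d k ^ M * Chat d 1 k ^ j ∂P d ≤
      2 ^ j * srwLaw d M 0 * (2 * π) ^ d +
        ((2 * π) ^ d * srwI d 5 0 0) ^ r * ((P d).real A) ^ (1 - r) := by
    rw [← integral_add_compl hA hF]; linarith
  have hI5nn : 0 ≤ srwI d 5 0 0 := by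
    rw [srwI_five_zero_eq]
    exact div_nonneg (integral_nonneg fun k => pow_nonneg (Chat_one_nonneg k) 5) hV.le
  rw [e0, ← div_add_rpow_eq hV hI5nn (measureReal_nonneg : 0 ≤ (P d).real A)]
  exact div_le_div_of_nonneg_right hmain hV.le

end SrwRemainder

end Literature.Probability.FitznerVanDerHofstad2017
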